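import Summits.AnomalousDissipation.AnomalousDissipation.Theorems.SolenoidalFractalHomogenisationLagrangianStepSidebandLadderSums
import Summits.AnomalousDissipation.AnomalousDissipation.Theorems.SolenoidalFractalHomogenisationLagrangianStepSidebandPickup
import HarnessLib

/-!
# K1L_D `stub_D1_V0thg` (stmt-AnomalousDissipation-27980), R3′ lane «SidebandTailCrushing» (tenure D28-16 (3) / D28-20) — file F4d(i):
# LADDER SIGNED COMMUTATOR — hypothesis (S) `h4` of the hypocoercivity lemma, with the box ends

Helper file of route `SolenoidalFractalHomogenisation` (prover seat `ad-k1l-cellLawV-w1` g10; plan memo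
`Cruxes/LagrangianRenormalisationStepDesign/Lines/onelevel-vtheta-R3-plan.md` §3 (S)(U); `--supports stmt-AnomalousDissipation-27980 --as helper`).
For a HOPPING ladder `L = z₀ + ℤmᵢ` (`êᵢ·z₀ ≠ 0`, hence every `z ∈ L` has `êᵢ·z ≠ 0`, so `z ≠ 0`, `z ± mᵢ ≠ 0`), a state `y ∈ ladderSub R L`, `K = indexL`,
`H = hopL`, `C = K H − H K`, `a = 2π|êᵢ·z₀|‖αᵢ‖`, `NearIso 𝔸 lo' hi'` (`lo' > 0`) and a box radius `R > M ≥ ‖mᵢ‖_∞`: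
* `siteIndex_mul_zdot_nonneg` — `κ(z)` has the sign of `z·m`; `abs_siteIndex_le_sqrt` — `|κ(z)| ≤ 3√|z|²`;
* `sq_le_freqNormSq_of_add_not_mem` — a BOX-END site (`z ∈ box`, `z ± m ∉ box`, `z ± m ≠ 0`) has `(R − M)² ≤ |z|²`;
* **(S) `inner_indexL_commutator_ge`**: `⟪Ky, C(Hy) − H(Cy)⟫_ℝ ≥ −η·⟪dampL y, y⟫_ℝ` with `η = 2a²·3/((R−M)·4π²lo')` — interior sites contribute `≥ 0`
  termwise by F2 `LadderCrush.signed_site`, the two box ends are absorbed by the damping;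
* (U) — `norm_sq_hopL_le`, `norm_sq_hopL_eq`, `coercive_ladder` — is file F4d(ii) `…SidebandLadderCoercive`.
No definitions, no sorry.  NOT a proof of `stub_D1_V0thg`, of K1L_D or of AD; rung F-D1.A0 infrastructure.
-/

set_option linter.dupNamespace false -- single-conjunct summit: `Summit.AnomalousDissipation.AnomalousDissipation.…` is the mandated namespace

noncomputable section

namespace Summit.AnomalousDissipation.AnomalousDissipation.Theorems.SolenoidalFractalHomogenisation.LagrangianStep.Sideband

open Set Complex
open scoped InnerProductSpace
open Literature.Analysis Literature.Analysis.FunctionSpaces Literature.Analysis.FunctionSpaces.Torus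
open Literature.Analysis.FluidPDE Literature.Analysis.FluidPDE.Torus Literature.Analysis.FluidPDE.LatticeShear
open Summit.AnomalousDissipation.AnomalousDissipation.Theorems.SolenoidalFractalHomogenisation.LagrangianStep.CellChain
  (linkCoeff kdot_transversalProj' inner_transversalProj_left_of_kdot_eq_zero norm_transversalProj_le)
open Summit.AnomalousDissipation.AnomalousDissipation.Theorems.SolenoidalFractalHomogenisation.LagrangianStep.W7Slot (dot_sq_le_freqNormSq_mul)

variable {k₀ : ℕ}

/-! ## §1 Sign and size of the site index; box-end sites -/

/-- **The site index has the sign of `z·m`**: `0 ≤ κ_m(z)·(z·m)` (`m ≠ 0`). [cite: BedrossianCotiZelati2017, §2] -/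
theorem siteIndex_mul_zdot_nonneg {m : Fin 3 → ℤ} (hr : 0 < zdot m m) (z : Fin 3 → ℤ) :
    0 ≤ siteIndex m z * (zdot z m : ℝ) := by
  rw [siteIndex_def]
  rcases le_or_gt 0 (zdot z m) with hq | hq
  · have h1 : 0 ≤ zdot z m / zdot m m := Int.ediv_nonneg hq hr.le
    have h1' : (0 : ℝ) ≤ ((zdot z m / zdot m m : ℤ) : ℝ) := by exact_mod_cast h1
    have hq' : (0 : ℝ) ≤ (zdot z m : ℝ) := by exact_mod_cast hq
    positivity
  · have h1 : zdot z m / zdot m m < 0 := Int.ediv_neg_of_neg_of_pos hq hr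
    have h1' : ((zdot z m / zdot m m : ℤ) : ℝ) ≤ -1 := by
      have : zdot z m / zdot m m ≤ -1 := by omega
      exact_mod_cast this
    have hq' : (zdot z m : ℝ) < 0 := by exact_mod_cast hq
    nlinarith

/-- `|κ_m(z)| ≤ 3·√|z|²` (`m ≠ 0`, `z ≠ 0`; from `κ² ≤ 7|z|²`, `√7 ≤ 3`). [cite: BedrossianCotiZelati2017, §2] -/
theorem abs_siteIndex_le_sqrt {m z : Fin 3 → ℤ} (hm : m ≠ 0) (hz : z ≠ 0) :
    |siteIndex m z| ≤ 3 * Real.sqrt (freqNormSq z) := by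
  have h := siteIndex_sq_le hm hz
  have hF := freqNormSq_nonneg z
  have h9 : siteIndex m z ^ 2 ≤ (3 * Real.sqrt (freqNormSq z)) ^ 2 := by
    rw [mul_pow, Real.sq_sqrt hF]; linarith
  exact abs_le_of_sq_le_sq' h9 (by positivity) |> fun h => abs_le.2 h

/-- **A box-end site is far out**: if `z + v ∉ box R`, `z + v ≠ 0` and `|v_j| ≤ M ≤ R` for all `j`, then `(R − M)² ≤ |z|²`.
[cite: MajdaKramer1999, §2.2.1.3 (truncated cell problem)] -/
theorem sq_le_freqNormSq_of_add_not_mem {R : ℕ} {M : ℝ} {z v : Fin 3 → ℤ} (hv : z + v ∉ box R) (hv0 : z + v ≠ 0)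
    (hM : ∀ j, |(v j : ℝ)| ≤ M) (hMR : M ≤ R) : ((R : ℝ) - M) ^ 2 ≤ freqNormSq z := by
  rw [mem_box] at hv
  push Not at hv
  obtain ⟨j, hj⟩ : ∃ j, ¬(-(R : ℤ) ≤ (z + v) j ∧ (z + v) j ≤ R) := by
    by_contra h
    push Not at h
    exact hv0 (hv fun j => h j)
  have hjR : (R : ℝ) < |((z j : ℝ) + (v j : ℝ))| := by
    rw [not_and_or, not_le, not_le] at hj
    rcases hj with hj | hj
    · have : ((z + v) j : ℝ) < -(R : ℝ) := by exact_mod_cast hj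
      simp only [Pi.add_apply, Int.cast_add] at this
      rw [lt_abs]; right; linarith
    · have : (R : ℝ) < ((z + v) j : ℝ) := by exact_mod_cast hj
      simp only [Pi.add_apply, Int.cast_add] at this
      rw [lt_abs]; left; linarith
  have hzj : (R : ℝ) - M < |(z j : ℝ)| := by
    have := abs_add_le (z j : ℝ) (v j : ℝ)
    linarith [hM j]
  have h0 : 0 ≤ (R : ℝ) - M := by linarith
  have hsq : ((R : ℝ) - M) ^ 2 ≤ (z j : ℝ) ^ 2 := by
    rw [← sq_abs (z j : ℝ)]; exact pow_le_pow_left₀ h0 hzj.le 2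
  refine hsq.trans ?_
  rw [freqNormSq]
  exact Finset.single_le_sum (f := fun k => (z k : ℝ) ^ 2) (fun k _ => sq_nonneg _) (Finset.mem_univ j)

/-- Box-end site, `z − v` form of `sq_le_freqNormSq_of_add_not_mem`. [cite: MajdaKramer1999, §2.2.1.3] -/
theorem sq_le_freqNormSq_of_sub_not_mem {R : ℕ} {M : ℝ} {z v : Fin 3 → ℤ} (hv : z - v ∉ box R) (hv0 : z - v ≠ 0)
    (hM : ∀ j, |(v j : ℝ)| ≤ M) (hMR : M ≤ R) : ((R : ℝ) - M) ^ 2 ≤ freqNormSq z := by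
  have e : z - v = z + -v := sub_eq_add_neg z v
  rw [e] at hv hv0
  exact sq_le_freqNormSq_of_add_not_mem hv hv0 (fun j => by rw [Pi.neg_apply, Int.cast_neg, abs_neg]; exact hM j) hMR

/-- At a box end the site index is paid by the weight: `ρ² ≤ |w|²`, `ρ > 0` ⇒ `|κ_m(w)| ≤ (3/ρ)·|w|²`. [cite: BedrossianCotiZelati2017, §2] -/
theorem abs_siteIndex_le_of_sq_le {m w : Fin 3 → ℤ} (hm : m ≠ 0) (hw : w ≠ 0) {ρ : ℝ} (hρ : 0 < ρ) (hbd : ρ ^ 2 ≤ freqNormSq w) :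
    |siteIndex m w| ≤ 3 / ρ * freqNormSq w := by
  have hκ := abs_siteIndex_le_sqrt hm hw
  have hF := freqNormSq_nonneg w
  have hsF : ρ ≤ Real.sqrt (freqNormSq w) := by
    rw [← Real.sqrt_sq hρ.le]; exact Real.sqrt_le_sqrt hbd
  have h1 : Real.sqrt (freqNormSq w) * ρ ≤ freqNormSq w := by
    calc Real.sqrt (freqNormSq w) * ρ ≤ Real.sqrt (freqNormSq w) * Real.sqrt (freqNormSq w) :=
          mul_le_mul_of_nonneg_left hsF (Real.sqrt_nonneg _)
      _ = freqNormSq w := Real.mul_self_sqrt hF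
  rw [div_mul_eq_mul_div, le_div_iff₀ hρ]
  nlinarith [Real.sqrt_nonneg (freqNormSq w)]

/-- At a box end the amplitude is paid by the weight: `ρ² ≤ |w|²`, `ρ > 0` ⇒ `t ≤ |w|²·t/ρ²` for `t ≥ 0`. [folklore] -/
theorem le_weight_div_of_sq_le {w : Fin 3 → ℤ} {ρ t : ℝ} (hρ : 0 < ρ) (hbd : ρ ^ 2 ≤ freqNormSq w) (ht : 0 ≤ t) :
    t ≤ freqNormSq w * t / ρ ^ 2 := by
  rw [le_div_iff₀ (by positivity)]
  nlinarith

/-- On a hopping ladder every site keeps the hop: `êᵢ·z ≠ 0` for `z ∈ ladder z₀ mᵢ` when `êᵢ·z₀ ≠ 0`; hence `z + v ≠ 0` for every `v ∈ ℤmᵢ`-translate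
on the ladder — in particular `z ≠ 0` and `z ± mᵢ ≠ 0`. [cite: MeshalkinSinai1961, pp. 1700–1705] -/
theorem ne_zero_of_mem_ladder (W₁ : LatticeWord k₀) (i : Fin k₀) {z₀ z : Fin 3 → ℤ} (hhop : ∑ a, (W₁.phase i).e a * (z₀ a : ℝ) ≠ 0)
    (hz : z ∈ ladder z₀ (W₁.phase i).m) : z ≠ 0 := by
  intro h
  have := sum_e_mul_eq_of_mem_ladder W₁ i hz
  rw [h] at this
  simp at this
  exact hhop this.symm

/-! ## §2 (S) The signed commutator with box ends -/

section Signed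

variable (W₁ : LatticeWord k₀) {R : ℕ} (i : Fin k₀) (z₀ : Fin 3 → ℤ)

set_option maxHeartbeats 400000 in -- pre-budgeted (ops-buildfix rule): heavy arithmetic, stay above the farm build cliff
/-- **(S) per site**: on a hopping ladder in a box of radius `R > M ≥ ‖mᵢ‖_∞`, for every retained `w`,
`−(3/(R−M))·|w|²‖y_w‖² ≤ κ(w)·([w+m ∈ box]‖P_{w+m}y_w‖² − [w−m ∈ box]‖P_{w−m}y_w‖²)` (interior: `≥ 0` by F2 `signed_site`; box ends: the weight pays).
[cite: BedrossianCotiZelati2017, §2 (the commutator term)] -/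
theorem signed_site_box (hhop : ∑ a, (W₁.phase i).e a * (z₀ a : ℝ) ≠ 0) {M : ℝ} (hM : ∀ j, |((W₁.phase i).m j : ℝ)| ≤ M) (hMR : M < R)
    {y : Space R} (hy : y ∈ ladderSub R (ladder z₀ (W₁.phase i).m)) (w : box R) :
    -(3 / ((R : ℝ) - M) * (freqNormSq w.1 * ‖y w‖ ^ 2)) ≤ siteIndex (W₁.phase i).m w.1 *
      ((if w.1 + (W₁.phase i).m ∈ box R then ‖transversalProj (w.1 + (W₁.phase i).m) (y w)‖ ^ 2 else 0) -
        (if w.1 - (W₁.phase i).m ∈ box R then ‖transversalProj (w.1 - (W₁.phase i).m) (y w)‖ ^ 2 else 0)) := by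
  have hm0 : (W₁.phase i).m ≠ 0 := (W₁.phase i).m_ne
  have hr : 0 < zdot (W₁.phase i).m (W₁.phase i).m := by
    have h : (0 : ℝ) < freqNormSq (W₁.phase i).m := freqNormSq_pos_of_ne_zero' hm0
    have e : (zdot (W₁.phase i).m (W₁.phase i).m : ℝ) = freqNormSq (W₁.phase i).m := by
      rw [cast_zdot, freqNormSq]; exact Finset.sum_congr rfl fun j _ => by ring
    exact_mod_cast (e ▸ h)
  have hRM : 0 < (R : ℝ) - M := by linarith
  have hF := freqNormSq_nonneg w.1
  have hyw := sq_nonneg ‖y w‖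
  have hneg : 0 ≤ 3 / ((R : ℝ) - M) * (freqNormSq w.1 * ‖y w‖ ^ 2) := by positivity
  by_cases hw : w.1 ∈ ladder z₀ (W₁.phase i).m
  · have hwp0 : w.1 + (W₁.phase i).m ≠ 0 := ne_zero_of_mem_ladder W₁ i hhop (add_mem_ladder hw)
    have hwm0 : w.1 - (W₁.phase i).m ≠ 0 := ne_zero_of_mem_ladder W₁ i hhop (sub_mem_ladder hw)
    have hk : kdot w.1 (y w) = 0 := kdot_eq_zero_of_mem_ladderSub hy w
    by_cases hp : w.1 + (W₁.phase i).m ∈ box R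
    · by_cases hq : w.1 - (W₁.phase i).m ∈ box R
      · -- interior
        rw [if_pos hp, if_pos hq]
        have hκ : 0 ≤ siteIndex (W₁.phase i).m w.1 * ∑ j, (w.1 j : ℝ) * (W₁.phase i).m j := by
          have := siteIndex_mul_zdot_nonneg hr w.1; rwa [cast_zdot] at this
        exact le_trans (neg_nonpos.2 hneg) (LadderCrush.signed_site hwp0 hwm0 hk hκ)
      · -- right box end: only `+` present
        rw [if_pos hp, if_neg hq, sub_zero]
        have hbd := sq_le_freqNormSq_of_sub_not_mem hq hwm0 hM hMR.le
        have hκF := abs_siteIndex_le_of_sq_le hm0 (ne_zero_of_mem_box w.2) hRM hbd (m := (W₁.phase i).m)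
        have hP : ‖transversalProj (w.1 + (W₁.phase i).m) (y w)‖ ^ 2 ≤ ‖y w‖ ^ 2 :=
          pow_le_pow_left₀ (norm_nonneg _) (norm_transversalProj_le _ _) 2
        have hP0 : 0 ≤ ‖transversalProj (w.1 + (W₁.phase i).m) (y w)‖ ^ 2 := sq_nonneg _
        have h1 : -|siteIndex (W₁.phase i).m w.1| ≤ siteIndex (W₁.phase i).m w.1 := neg_abs_le _
        have h2 : |siteIndex (W₁.phase i).m w.1| * ‖transversalProj (w.1 + (W₁.phase i).m) (y w)‖ ^ 2 ≤
            3 / ((R : ℝ) - M) * freqNormSq w.1 * ‖y w‖ ^ 2 :=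
          mul_le_mul hκF hP hP0 (by positivity)
        have h3 := mul_le_mul_of_nonneg_right h1 hP0
        linarith
    · by_cases hq : w.1 - (W₁.phase i).m ∈ box R
      · -- left box end: only `−` present
        rw [if_neg hp, if_pos hq, zero_sub, mul_neg]
        have hbd := sq_le_freqNormSq_of_add_not_mem hp hwp0 hM hMR.le
        have hκF := abs_siteIndex_le_of_sq_le hm0 (ne_zero_of_mem_box w.2) hRM hbd (m := (W₁.phase i).m)
        have hP : ‖transversalProj (w.1 - (W₁.phase i).m) (y w)‖ ^ 2 ≤ ‖y w‖ ^ 2 :=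
          pow_le_pow_left₀ (norm_nonneg _) (norm_transversalProj_le _ _) 2
        have hP0 : 0 ≤ ‖transversalProj (w.1 - (W₁.phase i).m) (y w)‖ ^ 2 := sq_nonneg _
        have h1 : siteIndex (W₁.phase i).m w.1 ≤ |siteIndex (W₁.phase i).m w.1| := le_abs_self _
        have h2 : |siteIndex (W₁.phase i).m w.1| * ‖transversalProj (w.1 - (W₁.phase i).m) (y w)‖ ^ 2 ≤
            3 / ((R : ℝ) - M) * freqNormSq w.1 * ‖y w‖ ^ 2 :=
          mul_le_mul hκF hP hP0 (by positivity)
        have h3 := mul_le_mul_of_nonneg_right h1 hP0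
        linarith
      · rw [if_neg hp, if_neg hq, sub_zero, mul_zero]
        exact neg_nonpos.2 hneg
  · rw [apply_eq_zero_of_mem_ladderSub hy hw, norm_zero, map_zero, map_zero, norm_zero]
    simp

set_option maxHeartbeats 400000 in -- pre-budgeted (ops-buildfix rule): heavy arithmetic, stay above the farm build cliff
/-- **(S) THE SIGNED-COMMUTATOR ALLOWANCE (hypothesis h4, hopping part).**  On a hopping ladder and a box of radius `R > M ≥ ‖mᵢ‖_∞`:
`⟪Ky, C(Hy) − H(Cy)⟫_ℝ ≥ −(2a²·3/((R−M)·4π²lo'))·⟪dampL y, y⟫_ℝ`. [cite: BedrossianCotiZelati2017, §2 (the commutator term)] -/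
theorem inner_indexL_commutator_ge (hhop : ∑ a, (W₁.phase i).e a * (z₀ a : ℝ) ≠ 0) {M : ℝ} (hM : ∀ j, |((W₁.phase i).m j : ℝ)| ≤ M)
    (hMR : M < R) {𝔸 : Torus.Visc4 (Fin 3)} {lo' hi' : ℝ} (h𝔸 : Torus.NearIso 𝔸 lo' hi') (hlo' : 0 < lo') (γ₁ : ℝ)
    {y : Space R} (hy : y ∈ ladderSub R (ladder z₀ (W₁.phase i).m)) :
    -(2 * (2 * Real.pi * |∑ a, (W₁.phase i).e a * (z₀ a : ℝ)| * ‖slotAmp W₁ i‖) ^ 2 * 3 / (((R : ℝ) - M) * (4 * Real.pi ^ 2 * lo')) *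
        ⟪dampL 𝔸 γ₁ R y, y⟫_ℝ) ≤
      ⟪indexL R (W₁.phase i).m y,
        (indexL R (W₁.phase i).m (hopL W₁ R i (hopL W₁ R i y)) - hopL W₁ R i (indexL R (W₁.phase i).m (hopL W₁ R i y))) -
          hopL W₁ R i (indexL R (W₁.phase i).m (hopL W₁ R i y) - hopL W₁ R i (indexL R (W₁.phase i).m y))⟫_ℝ := by
  have hRM : 0 < (R : ℝ) - M := by linarith
  rw [inner_indexL_commutator W₁ i z₀ hy]
  have hsum : -(3 / ((R : ℝ) - M) * ∑ w : box R, freqNormSq w.1 * ‖y w‖ ^ 2) ≤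
      ∑ w : box R, siteIndex (W₁.phase i).m w.1 *
        ((if w.1 + (W₁.phase i).m ∈ box R then ‖transversalProj (w.1 + (W₁.phase i).m) (y w)‖ ^ 2 else 0) -
          (if w.1 - (W₁.phase i).m ∈ box R then ‖transversalProj (w.1 - (W₁.phase i).m) (y w)‖ ^ 2 else 0)) := by
    rw [Finset.mul_sum, ← Finset.sum_neg_distrib]
    exact Finset.sum_le_sum fun w _ => signed_site_box W₁ i z₀ hhop hM hMR hy w
  have hD := real_inner_dampL_ge h𝔸 γ₁ hy
  have hS : 0 ≤ ∑ w : box R, freqNormSq w.1 * ‖y w‖ ^ 2 := Finset.sum_nonneg fun w _ => mul_nonneg (freqNormSq_nonneg _) (sq_nonneg _)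
  have ha2 : 0 ≤ (2 * Real.pi * |∑ a, (W₁.phase i).e a * (z₀ a : ℝ)| * ‖slotAmp W₁ i‖) ^ 2 := by positivity
  -- generic scalar step
  have key : ∀ A S D T lo ρ : ℝ, 0 ≤ A → 0 < lo → 0 < ρ → 4 * Real.pi ^ 2 * lo * S ≤ D → -(3 / ρ * S) ≤ T →
      -(2 * A * 3 / (ρ * (4 * Real.pi ^ 2 * lo)) * D) ≤ 2 * A * T := by
    intro A S D T lo ρ hA hlo hρ hSD hT
    have hπ : 0 < 4 * Real.pi ^ 2 * lo := by positivity
    have h1 : 2 * A * 3 / (ρ * (4 * Real.pi ^ 2 * lo)) * (4 * Real.pi ^ 2 * lo * S) ≤ 2 * A * 3 / (ρ * (4 * Real.pi ^ 2 * lo)) * D :=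
      mul_le_mul_of_nonneg_left hSD (by positivity)
    have e : 2 * A * 3 / (ρ * (4 * Real.pi ^ 2 * lo)) * (4 * Real.pi ^ 2 * lo * S) = 2 * A * (3 / ρ * S) := by
      field_simp
    have h2 := mul_le_mul_of_nonneg_left hT (by positivity : (0:ℝ) ≤ 2 * A)
    rw [mul_neg] at h2
    linarith
  exact key _ _ _ _ lo' ((R : ℝ) - M) ha2 hlo' hRM hD hsum

end Signed

end Summit.AnomalousDissipation.AnomalousDissipation.Theorems.SolenoidalFractalHomogenisation.LagrangianStep.Sideband

end
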